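import Summits.Parity.GeneralizedHardyLittlewood.Theses.GoldbachHeathBrownDispersion
import Literature.NumberTheory.Sieve.CubicMinorantFourierSide
import HarnessLib

/-!
# Route `GoldbachHeathBrownDispersion` — support item `FourierSideComparison` (stmt-Parity-19913)

The support item `FourierSideComparison` (replacing the full prime `θ(m)·𝟙_ℙ(m)` by the rough model
`roughModel B (2N)` against the Heath-Brown weight at an `L²(n)` cost `≤ C N³ (log N)^{−A}`) is,
verbatim, the Literature kernel theorem
`Literature.NumberTheory.Sieve.CubicMinorant.fourierSideComparison`
(file `Literature/NumberTheory/Sieve/CubicMinorantFourierSide.lean`, cell parity-ideate lit g14,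
p524214): Parseval for the product of the two generating functions, the `L⁴` restriction bound for
the Heath-Brown weight, the uniform Fourier approximation of `Λ` by the rough model
(Siegel–Walfisz/Vaughan) and Chebyshev's `ψ − θ` comparison.  This file closes the item by name.

References: R. C. Vaughan, *The Hardy–Littlewood Method* (1997) §3.1–§3.2 [Vaughan1997];
H. L. Montgomery, R. C. Vaughan, Acta Arith. 27 (1975) §7 [MontgomeryVaughan1975].
-/

namespace Summit.Parity.GeneralizedHardyLittlewood.Theorems

/-- **`FourierSideComparison` holds** (route `GoldbachHeathBrownDispersion`, support stmt-Parity-19913):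
for every `c > 0` and `A > 0` there are `B > 0`, `C`, `N₀` with
`∑_{N<n≤2N} (∑_{k≤N} hbWeight c N k · (θ𝟙_ℙ(n − k) − roughModel B (2N) (n − k)))² ≤ C N³ (log N)^{−A}`
for `N ≥ N₀`.  Proof: the Literature theorem `CubicMinorant.fourierSideComparison` is this
statement. -/
theorem goldbachHeathBrownDispersion_fourierSideComparison_proof :
    Summit.Parity.GeneralizedHardyLittlewood.Theses.GoldbachHeathBrownDispersion.FourierSideComparison := by
  unfold Summit.Parity.GeneralizedHardyLittlewood.Theses.GoldbachHeathBrownDispersion.FourierSideComparison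
  exact Literature.NumberTheory.Sieve.CubicMinorant.fourierSideComparison

end Summit.Parity.GeneralizedHardyLittlewood.Theorems
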